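import Literature.NumberTheory.EllipticCurves.KleinQuinticTorsionFrame
import Literature.NumberTheory.EllipticCurves.Fisher2012.HesseFamilyFiveClosedForms
import HarnessLib

/-!
# Fisher 2012, Theorem 13.2 (i), `n = 5`: the named fact `Fisher2012.thm132_fiveCongruent_hessePencil` DISCHARGED

`Literature/NumberTheory/EllipticCurves/Fisher2012/HesseFamilyFiveCongruence.lean` states, as the NAMED FACT
`Fisher2012.thm132_fiveCongruent_hessePencil` (cell `b2b-bsdres`), Fisher's Theorem 13.2 (i) for `n = 5` over
`ℚ`: every non-singular member `E_{λ,μ} : y² = x³ − 27𝔠₄(λ,μ)x − 54𝔠₆(λ,μ)` of the Hesse pencil of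
`E : y² = x³ − 27c₄x − 54c₆` has `E_{λ,μ}[5] ≅ E[5]` as `Γ_ℚ`-modules, with Fisher's `𝔠₄, 𝔠₆` built from the
dodecic `𝔇` by `MvPolynomial.pderiv` (Hessian / Jacobian determinants, §8 of the paper).

The tree holds a SECOND formulation of the same printed statement,
`HesseFamilyFive.thm132_geomTorsionFive_of_hesseFamily` (`ModFiveCongruenceHesseFamily.lean`, written for the crux
`FreyModularity` of `Summits/ABC`), whose Hesse polynomials `HesseFamilyFive.C4 / C6`
(`ModFiveCongruenceHessePolynomials.lean`) are explicit closed forms; that formulation is now PROVED in the tree: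
`KleinQuinticTorsion.thm132_geomTorsionFive_of_hesseFamily_holds` (`KleinQuinticTorsionFrame.lean`, a linear frame
on Klein's quintic model run on the certified section table of `KleinQuinticSectionTable(Certs)`).

This file is the dictionary between the two formulations and the resulting discharge:

* `C4_eq_eval_hesseC4`, `C6_eq_eval_hesseC6` — the closed forms `HesseFamilyFive.C4 / C6` ARE the evaluations of
  Fisher's `pderiv`-defined `Fisher2012.hesseC4 / hesseC6` (pure `ring` identities of degrees 20 / 30 after the
  proved closed forms `Fisher2012.eval_hesseC4 / eval_hesseC6` of `HesseFamilyFiveClosedForms.lean`);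
* `member_eq_hessePencil5` — hence the two pencils consist of the SAME Weierstrass curves;
* `thm132_fiveCongruent_hessePencil_of_hesseFamily` / `hesseFamily_of_fiveCongruent_hessePencil` — the two named
  facts are equivalent;
* `thm132_fiveCongruent_hessePencil_holds : thm132_fiveCongruent_hessePencil` — Fisher 13.2 (i), `n = 5`, in the
  `b2b-bsdres` formulation, PROVED (the named fact stays a `def`; its `(h : …)` consumers are fed this theorem).

It cannot be appended to the fact's own file: the proof imports `KleinQuinticTorsionFrame` and
`HesseFamilyFiveClosedForms`, and the latter imports `HesseFamilyFiveCongruence` itself.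

Provenance of the dictionary lemmas: the crux workfile
`Summits/ABC/ABC/Cruxes/FreyModularity/STUB_IDEAS_stub_switch_2g14_Bridge.lean` (stub-ideation k2, gen 14), H1a/H1b/H1/
H2/H2′, re-homed to namespace `Literature.NumberTheory.EllipticCurves.Fisher2012`; nothing else is new.
No new definition, no new named fact; net debt −1.

## References
* [Fisher2012Hessian] T. Fisher, *The Hessian of a genus one curve*, Proc. LMS (3) 104 (2012) 613–648, §8 and
  Thm. 13.2 (i) (case `n = 5`).
-/

namespace Literature.NumberTheory.EllipticCurves.Fisher2012

open _root_.Literature.NumberTheory.EllipticCurves.HesseFamilyFive _root_.WeierstrassCurve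

/-! ## The polynomial dictionary -/

/-- Fisher's `𝔠₄(λ,μ)` for `n = 5`: the closed form `HesseFamilyFive.C4` equals the evaluation at `(l, m)` of the
`pderiv`-defined `Fisher2012.hesseC4`. [cite: Fisher2012Hessian, §8 (n = 5, display defining 𝔠₄)] -/
theorem C4_eq_eval_hesseC4 (c₄ c₆ l m : ℚ) :
    C4 c₄ c₆ l m = MvPolynomial.eval ![l, m] (hesseC4 c₄ c₆) := by
  rw [eval_hesseC4]
  simp only [C4, Dll, Dmm, Dlm]
  ring

/-- Fisher's `𝔠₆(λ,μ)` for `n = 5`: the closed form `HesseFamilyFive.C6` equals the evaluation at `(l, m)` of the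
`pderiv`-defined `Fisher2012.hesseC6`. [cite: Fisher2012Hessian, §8 (n = 5, display defining 𝔠₆)] -/
theorem C6_eq_eval_hesseC6 (c₄ c₆ l m : ℚ) :
    C6 c₄ c₆ l m = MvPolynomial.eval ![l, m] (hesseC6 c₄ c₆) := by
  rw [eval_hesseC6]
  simp only [C6, C4l, C4m, Dl, Dm, Dll, Dmm, Dlm, Dlll, Dllm, Dlmm, Dmmm]
  ring

/-- The two Hesse pencils of the tree coincide member by member: the `HesseFamilyFive` member
`y² = x³ − 27·C4(c₄,c₆,l,m)·x − 54·C6(c₄,c₆,l,m)` IS `Fisher2012.hessePencil5 c₄ c₆ l m`.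
[cite: Fisher2012Hessian, Thm. 13.2 (the family E_{λ,μ})] -/
theorem member_eq_hessePencil5 (c₄ c₆ l m : ℚ) :
    (⟨0, 0, 0, -27 * C4 c₄ c₆ l m, -54 * C6 c₄ c₆ l m⟩ : WeierstrassCurve ℚ) = hessePencil5 c₄ c₆ l m := by
  rw [hessePencil5, C4_eq_eval_hesseC4, C6_eq_eval_hesseC6]

/-! ## The two named facts are equivalent -/

/-- `HesseFamilyFive.thm132_geomTorsionFive_of_hesseFamily` ⇒ `Fisher2012.thm132_fiveCongruent_hessePencil`
(same printed theorem, two vocabularies). [cite: Fisher2012Hessian, Thm. 13.2 (i), n = 5] -/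
theorem thm132_fiveCongruent_hessePencil_of_hesseFamily (hF : thm132_geomTorsionFive_of_hesseFamily) :
    thm132_fiveCongruent_hessePencil := by
  intro c₄ c₆ l m _ _
  exact hF (c4c6Model c₄ c₆) (hessePencil5 c₄ c₆ l m) c₄ c₆ l m rfl (member_eq_hessePencil5 c₄ c₆ l m).symm

/-- `Fisher2012.thm132_fiveCongruent_hessePencil` ⇒ `HesseFamilyFive.thm132_geomTorsionFive_of_hesseFamily`
(converse direction of the dictionary). [cite: Fisher2012Hessian, Thm. 13.2 (i), n = 5] -/
theorem hesseFamily_of_fiveCongruent_hessePencil (hF : thm132_fiveCongruent_hessePencil) :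
    thm132_geomTorsionFive_of_hesseFamily := by
  intro E E' iE iE' c₄ c₆ l m hE hE'
  subst hE
  rw [member_eq_hessePencil5] at hE'
  subst hE'
  haveI : (c4c6Model c₄ c₆).IsElliptic := iE
  exact hF c₄ c₆ l m

/-! ## The discharge -/

/-- **Fisher 2012, Theorem 13.2 (i), `n = 5`, `K = ℚ` — the named fact `Fisher2012.thm132_fiveCongruent_hessePencil`
PROVED**: every non-singular member `E_{λ,μ}` (`λ, μ ∈ ℚ`) of the Hesse pencil of an elliptic curve
`E : y² = x³ − 27c₄x − 54c₆` satisfies `E_{λ,μ}[5] ≅ E[5]` as `Γ_ℚ`-modules. Proof: the tree's theorem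
`KleinQuinticTorsion.thm132_geomTorsionFive_of_hesseFamily_holds` (linear frame on Klein's quintic model + certified
section table) transported along the dictionary above. [cite: Fisher2012Hessian, Thm. 13.2 (i), n = 5] -/
theorem thm132_fiveCongruent_hessePencil_holds : thm132_fiveCongruent_hessePencil :=
  thm132_fiveCongruent_hessePencil_of_hesseFamily KleinQuinticTorsion.thm132_geomTorsionFive_of_hesseFamily_holds

end Literature.NumberTheory.EllipticCurves.Fisher2012
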